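import Literature.Geometry.Kaehler.AutStableTorusEigencharacterGaloisStabilizer
import Literature.Geometry.Kaehler.ComplexTorusHodgeGroupAlmostQSimpleRadical
import Literature.Geometry.Kaehler.ComplexTorusHodgeLieAlgebraRatProductSolvableFactor
import Literature.Geometry.Kaehler.ComplexTorusHodgeGroupComplexCommutant
import Literature.Geometry.Kaehler.ComplexTorusHodgeGroupProductProjectionsSurjective
import Literature.Geometry.Kaehler.ComplexTorusEllipticCurveHodgeGroupComplexPoints
import Literature.Geometry.Kaehler.ComplexTorusEllipticCurveEndomorphismRing
import Literature.Geometry.Kaehler.ComplexTorusLefschetzGroupFiniteProduct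
import Literature.Geometry.Kaehler.ComplexTorusMumfordTateGroupRadical
import Literature.NumberTheory.Automorphic.LieAlgebraGLExponentialGenerators
import Literature.NumberTheory.Automorphic.TorusLieAlgebraIntegralSpan
import Literature.NumberTheory.Automorphic.CentralizerLieAlgebra
import Literature.NumberTheory.Automorphic.TorusTorsion
import Literature.LinearAlgebra.CommonEigenvectorOfCommute
import Literature.FieldTheory.AlgClosed.AutComplexFiniteIndex
import Mathlib.Algebra.Algebra.Hom.Rat
import HarnessLib

/-!
# Moonen–Zarhin 1999 §3 Proposition (3.8), the half with complex multiplication: if `E` is an elliptic curve with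
# `End⁰(E) = k` imaginary quadratic and `Hg(X × E) ≠ Hg(X) × Hg(E)`, then `k` EMBEDS INTO THE CENTRE OF `End⁰(X)`

Layer `Literature/Geometry/Kaehler`, namespace `Literature.Geometry.Kaehler.ComplexTorus`; lane `lit-hodgefound` (Track 2
foundations library), Layer A4; prover seat `lit-hodgefound-p17` (generation 44, self-proposed row g44-#4), the Hodge-theoretic
instantiation of `AutStableTorusEigencharacterGaloisStabilizer` (g44-#3: for an `Aut(ℂ)`-stable torus `S ≤ GL_N(ℂ)` and a Galois
SIGN PAIR of joint eigenvectors `e₊, e₋` of `Lie S`, some «`X`-type» joint eigenvector `v` has the property that every field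
automorphism of `ℂ` fixing the eigenvalues on `v` of the RATIONAL points of `Lie S` fixes `e₊`).  THEOREMS ONLY (no definition, no
instance, no notation, no named fact; D-0026 net debt `0`).

DICTIONARY.  `X = E₁ ∕ Φ₁(ℤ^ι₁)` a polarised complex torus (`IsRiemannForm Φ₁ η₁`), `E_τ = ℂ ∕ (ℤτ + ℤ)` the elliptic curve of
`ellipticPeriod hτ` (`τ ∉ ℝ`), with complex multiplication: `ellipticEnd hτ ≠ ⊥`, equivalently (`ellipticEnd_ne_bot_iff`)
`τ² + pτ + q = 0` for some `p q : ℚ`, so that `k = End⁰(E_τ) = ℚ(τ)` is an imaginary quadratic field.  `Hg(·)(ℂ) = hodgeGroupC`,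
`Hg(X)(ℂ) × Hg(E)(ℂ) = blockDiagProd`, `End⁰(X) = endAlgRat Φ₁ ⊆ M_ι₁(ℚ)` (rational representation on `H₁(X, ℚ) = ℚ^ι₁`), its centre
`Subalgebra.center ℚ (endAlgRat Φ₁)`.  An EMBEDDING OF `k` INTO THE CENTRE is rendered as follows: the centre `C` of `End⁰(X)` is a
commutative semisimple `ℚ`-algebra acting on `V_ℂ = ℂ^ι₁`; a common eigenvector `y ≠ 0` of `C` has an eigencharacter
`χ : C →ₐ[ℚ] ℂ`, whose image `χ(C) ⊆ ℂ` is (a complex embedding of) a simple factor `F` of `C`; the conclusion `τ ∈ χ(C)` says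
`k = ℚ(τ) ⊆ χ(C) ≅ F`, i.e. `k ↪ F ⊆ C` («there exists an embedding `k → F_i`», Moonen–Zarhin's last sentence).

## Sources, verbatim

* B. Moonen, Yu. G. Zarhin [MoonenZarhin1999LowDim], *Hodge classes on abelian varieties of low dimension*, Math. Ann. **315**
  (1999) 711–733, held `paper:arxiv-math_9901113` (the held text carries no statement numbers; locators are page∕line of the
  materialised text).  §3 Proposition (3.8) (p0007 L55–L59): "Let `X` be an abelian variety and let `E` be an elliptic curve, both
  over `ℂ`. Suppose `Hom(E,X) = 0`. Then either `Hg(X × E) = Hg(X) × Hg(E)` or `End⁰(E) = k` is an imaginary quadratic field such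
  that there exists an embedding of `k` into the center of `End⁰(X)`."  Proof (p0007 L61–L74): "If `End⁰(E) = ℚ` then we apply
  Lemma (3.4). Hence we may assume that `End⁰(E) = k` is an imaginary quadratic field, so that `Hg(E)` is the rank 1 torus `U_k`.
  Write `C` for the center of `End⁰(X)`. Then `C` has the form `C = K_1 × ⋯ × K_m × F_1 × ⋯ × F_n`, where `K_1, …, K_m` are
  totally real fields and `F_1, ⋯, F_n` are CM-fields. The center `Z` of `Hg(X)` is contained in `U_{F_1} × ⋯ × U_{F_n}`. By
  Lemma (3.6), if `Hg(X × E) ≠ Hg(X) × Hg(E)` then there is a homomorphism `U_k → U_{F_1} × ⋯ × U_{F_n}` with finite kernel. If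
  `U_{F_i}` is a factor such that the projection of `U_k` to `U_{F_i}` has rank 1 then it easily follows from Lemma (3.7) that there
  exists an embedding `k → F_i`. This proves the claim."  (In the CM case the hypothesis `Hom(E, X) = 0` is not used by the proof,
  and it is not assumed here.)
* H. Lange [Lange2023AbelianVarietiesComplex], *Abelian Varieties over the Complex Numbers*, §7.2.2 Prop. 7.2.5
  (`End_ℚ(X) = End(V)^{Hg(X)}`), §7.2.3 Prop. 7.2.6 (CM type ⟺ `Hg(X)` a torus; "the centralizer of `T` is `T` itself"),
  §2.1.1 Example 2.1.3 (`E_τ`), §1.1.2 Prop. 1.1.6 (rational and analytic representations).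
* T. A. Springer [Springer1998], *Linear Algebraic Groups*, 2nd ed., 7.3.1 (i) ("The radical `R(G)` is a central torus. It is the
  identity component of the center of `G`"), 4.4.13 (a torus is diagonalisable), 12.1.7 (d).
* J.-P. Serre [Serre1977], *Linear Representations of Finite Groups*, §2.3 (isotypic projections) — through g44-#1.
* S. Lang [Lang2002], *Algebra*, Ch. VIII §1 (automorphisms of `ℂ` over a countable subfield) — through
  `Complex.mem_of_forall_mem_fixingSubgroup`.

## The proof formalised (Moonen–Zarhin's «it easily follows from Lemma (3.7)», at the level of Lie algebras and eigenvalues)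

Let `G = Hg(X × E)(ℂ) ≤ GL(V_ℂ ⊕ ℂ²)` and `S = R(G) = Z(G)°` its radical, an `Aut(ℂ)`-stable torus
(`IsRiemannForm.isTorusSubgroup_radical_map_toGL_hodgeGroupC`, `isAutStableGL_radical_map_toGL_hodgeGroupC`) — the complex points of
the centre `Z` of `Hg(X × E)`, which maps onto `U_k = Hg(E)` and into `Z(Hg(X)) ⊆ U_{F_1} × ⋯ × U_{F_n}`.  Fix integers with
`Dτ² + Pτ + Q = 0`, `D ≠ 0`; the integer matrix `(−P D; −Q 0)` is «multiplication by `Dτ`» on `H₁(E_τ, ℤ) = ℤτ ⊕ ℤ`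
(`mem_endRingInt_of_eq_mul`), with eigenlines `e₊ = (D, Dτ + P)` (eigenvalue `Dτ`) and `e₋ = (D, −Dτ)` (eigenvalue `−Dτ − P`) in
`H₁(E, ℂ) = ℂ²`; every `σ ∈ Aut(ℂ)` fixes or swaps `e₊, e₋` (it permutes the roots of `DT² + PT + Q`) — the SIGN character of
`Gal(k/ℚ)`.  Every `H ∈ Lie S ⊆ Lie G` is block diagonal with `E`-block in `Lie Hg(E)(ℂ) = 𝒜(E) ⊗ ℂ ⊆ k ⊗ ℂ` of trace `0`, so
`H e₊ = μ e₊`, `H e₋ = −μ e₋` (§2).  FINITE KERNEL (§3): if `H ∈ Lie S` kills every joint eigenvector with non-zero `X`-component then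
its `X`-rows vanish, so its `E`-block lies in `Lie K₂ = 0` (`K₂° = 1` for a non-split product with a CM elliptic curve, g43
`identityComponent_hodgeGroupCProdInr_eq_bot_or_eq_of_almostQSimple`), and `H = 0`.  NON-DEGENERACY (§3): the trace-free
`W₀ = 2(−P D; −Q 0) + P ∈ 𝒜(E)` pairs (g42 ★) with a central `B ∈ End⁰(X) ∩ 𝒜(X)`, `(B 0; 0 W₀) ∈ 𝒜(X × E)`; this element commutes
with `Lie G`, so its exponentials are central in `G` (`IsZConnected.exists_mem_center_coe_eq_exp`) and it lies in
`Lie Z(G)° = Lie R(G)` (Springer 7.3.1 (i)); and `W₀ e₊ = D(2Dτ + P) e₊ ≠ 0`.  Hence g44-#3 applies: there is a joint eigenvector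
`v = (x, ∗)` of `Lie S` with `x ≠ 0` such that every `σ` fixing the eigenvalues on `v` of the rational points `A ∈ Lie S` fixes
`e₊`, i.e. fixes `τ`.  EXTRACTION (§1, §4): the `X`-block `A₁₁` of a rational `A ∈ Lie S` lies in `𝒜(X)` and commutes with
`Hg(X)(ℂ)` (`S` is central in `G`, and `Hg(X × E) → Hg(X)` is onto), hence `A₁₁ ∈ End_ℚ(V)^{Hg(X)} = End⁰(X)` (Lange 7.2.5) is
CENTRAL; the joint eigenspace `U ∋ x` of these `A₁₁` is stable under the centre `C`, a common eigenvector `y ∈ U` of the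
commutative `C` has an eigencharacter `χ`, and every `σ ∈ Aut(ℂ/ℚ(χ(C)))` fixes all the eigenvalues `χ(A₁₁)`, hence fixes `τ`:
`τ ∈ ℚ(χ(C)) = χ(C)` by the Galois correspondence for `Aut(ℂ)` (`Complex.mem_of_forall_mem_fixingSubgroup`).

## What is proved

* §1 (private) `exists_eigencharacter₄₄`: the extraction engine (common eigenvector of a commutative `ℚ`-algebra of rational
  matrices on a joint eigenspace, its eigencharacter, and the Galois step).
* §2 (private) the CM line: `exists_int_quadratic₄₄`, `cmMatrix_mem_endAlgRat₄₄`, the eigenlines and the sign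
  (`cmMatrix_mulVec_eP₄₄`, `cmMatrix_mulVec_eM₄₄`, `comp_eP_eM₄₄`), `exists_eq_smul_of_comm₄₄`.
* §3 (private) the Hodge set-up on `S = R(Hg(X × E)(ℂ))`: `toBlocks_of_mem_lieAlgebraGL_radical₄₄` (block form),
  `exists_mulVec_eP_eM₄₄` (opposite eigenvalues), `eq_zero_of_forall_jointEigenvector₄₄` (finite kernel),
  `exists_mulVec_eP_ne_zero₄₄` (non-degeneracy), `toBlocks₁₁_mem_endAlgRat_of_map_mem_lieAlgebraGL_radical₄₄` (the `X`-blocks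
  of the rational points of `Lie S` are central endomorphisms).
* §4 **`IsRiemannForm.exists_eigencharacter_center_endAlgRat_of_hodgeGroupC_prod_ellipticPeriod_ne`** — Proposition (3.8), CM half,
  as displayed above; `IsAbelianVariety.exists_eigencharacter_center_endAlgRat_of_hodgeGroupC_prod_ellipticPeriod_ne` (the same for an
  abelian variety `X`, polarisation unnamed).
* §5 Proposition (3.8) read as a SPLITTING CRITERION: **`IsRiemannForm.hodgeGroupC_prod_ellipticPeriod_eq_blockDiagProd_of_forall_im_eq_zero`**
  (every complex embedding of the centre of `End⁰(X)` real — no CM factor `F_i` — ⟹ `Hg(X × E) = Hg(X) × Hg(E)` for every CM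
  elliptic curve `E`), `IsRiemannForm.hodgeGroupC_prod_ellipticPeriod_eq_blockDiagProd_of_center_eq_bot` (centre `ℚ`), and the
  `IsAbelianVariety.` twins.
-/

open Matrix Module Function
open scoped MatrixGroups

namespace Literature.Geometry.Kaehler

namespace ComplexTorus

open Literature.NumberTheory.Automorphic (IsZConnected IsTorusSubgroup IsConnectedReductive IsAlgebraicSubgroup lieAlgebraGL
  radical radical_le identityComponent lieAlgebraGL_identityComponent lieAlgebraGL_bot lieAlgebraGL_mono
  isAlgebraicSubgroup_centralizer_set mem_lieAlgebraGL_of_forall_real_exp_smul_mem conj_eq_self_of_mem_lieAlgebraGL_of_forall_commute)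
open Literature.Geometry.Kaehler.AutStableTorus (exists_jointEigenvector_forall_ringEquiv_apply_eq)
open Literature.LinearAlgebra (exists_ne_zero_forall_apply_eq_smul_of_commute)
open Literature.FieldTheory.AlgClosed (Complex.mem_of_forall_mem_fixingSubgroup)

/-! ### §0 Plumbing -/

section Plumbing

variable {m : Type*} [Fintype m] [DecidableEq m]

omit [DecidableEq m] in
/-- `(A B) ⊗ 1 = (A ⊗ 1)(B ⊗ 1)`. [folklore] -/
private theorem map_ratCast_mul₄₄ (A B : Matrix m m ℚ) :
    (A * B).map ((↑) : ℚ → ℂ) = A.map ((↑) : ℚ → ℂ) * B.map ((↑) : ℚ → ℂ) :=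
  Matrix.map_mul (f := Rat.castHom ℂ)

omit [DecidableEq m] in
/-- `tr (A ⊗ 1) = tr A`. [folklore] -/
private theorem trace_map_ratCast₄₄ (A : Matrix m m ℚ) : (A.map ((↑) : ℚ → ℂ)).trace = ((A.trace : ℚ) : ℂ) := by
  simp [Matrix.trace, Matrix.map_apply]

omit [Fintype m] [DecidableEq m] in
/-- `algebraMap ℚ ℂ` is the cast, on matrices. [folklore] -/
private theorem map_algebraMap_eq₄₄ (A : Matrix m m ℚ) : A.map (algebraMap ℚ ℂ) = A.map ((↑) : ℚ → ℂ) := by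
  ext i j; simp [Matrix.map_apply]

variable {ι₁ : Type*}

/-- `(0, e) ≠ 0` for `e ≠ 0`. [folklore] -/
private theorem elim_zero_ne_zero₄₄ {e : Fin 2 → ℂ} (he : e ≠ 0) : Sum.elim (0 : ι₁ → ℂ) e ≠ 0 := by
  intro h
  apply he
  funext i
  have := congrFun h (Sum.inr i)
  simpa using this

/-- `(A 0; 0 B)(0, e) = (0, B e)`. [folklore] -/
private theorem fromBlocks_mulVec_elim_zero₄₄ [Fintype ι₁] (A : Matrix ι₁ ι₁ ℂ) (B : Matrix (Fin 2) (Fin 2) ℂ)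
    (e : Fin 2 → ℂ) : fromBlocks A 0 0 B *ᵥ Sum.elim (0 : ι₁ → ℂ) e = Sum.elim (0 : ι₁ → ℂ) (B *ᵥ e) := by
  rw [Matrix.fromBlocks_mulVec, Sum.elim_comp_inl, Sum.elim_comp_inr, Matrix.mulVec_zero, Matrix.zero_mulVec,
    Matrix.zero_mulVec, zero_add, zero_add]

/-- `μ (0, e) = (0, μ e)`. [folklore] -/
private theorem smul_elim_zero₄₄ (μ : ℂ) (e : Fin 2 → ℂ) : μ • Sum.elim (0 : ι₁ → ℂ) e = Sum.elim (0 : ι₁ → ℂ) (μ • e) := by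
  funext x; cases x <;> simp

/-- `−(0, e) = (0, −e)`. [folklore] -/
private theorem neg_elim_zero₄₄ (e : Fin 2 → ℂ) : -Sum.elim (0 : ι₁ → ℂ) e = Sum.elim (0 : ι₁ → ℂ) (-e) := by
  funext x; cases x <;> simp

/-- `(μ v)|_X = μ (v|_X)`. [folklore] -/
private theorem smul_comp_inl₄₄ (μ : ℂ) (v : ι₁ ⊕ Fin 2 → ℂ) : (μ • v) ∘ Sum.inl = μ • (v ∘ Sum.inl) := rfl

/-- `σ(0, e) = (0, σ e)`. [folklore] -/
private theorem comp_elim_zero₄₄ (σ : ℂ ≃+* ℂ) (e : Fin 2 → ℂ) :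
    (σ : ℂ → ℂ) ∘ Sum.elim (0 : ι₁ → ℂ) e = Sum.elim (0 : ι₁ → ℂ) ((σ : ℂ → ℂ) ∘ e) := by
  funext x; cases x <;> simp

end Plumbing

/-! ### §1 The extraction engine: a common eigenvector of a commutative `ℚ`-algebra on a joint eigenspace, and the Galois step -/

section Extraction

variable {ι₁ : Type*} [Fintype ι₁] [DecidableEq ι₁]

/-- **Extraction.**  `Z` a commutative finite-dimensional `ℚ`-algebra of rational matrices (through `f`), `𝒜 ⊆ f(Z)`, `x ≠ 0` a
complex vector, `τ ∈ ℂ` fixed by every `σ ∈ Aut(ℂ)` that fixes the eigenvalues on `x` of the members of `𝒜`.  Then some common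
eigenvector `y ≠ 0` of `f(Z)` (taken in the joint eigenspace of `𝒜` through `x`) has an eigencharacter `χ : Z →ₐ[ℚ] ℂ` with
`τ ∈ χ(Z)`: every `σ ∈ Aut(ℂ/ℚ(χ(Z)))` fixes the eigenvalues `χ(f⁻¹ A)` of `A ∈ 𝒜` on `y`, which are those on `x`.
[cite: MoonenZarhin1999LowDim, §3 Prop. (3.8), proof (p0007 L71–L74)] [cite: Lang2002, Ch. VIII §1] -/
private theorem exists_eigencharacter₄₄ {A₀ : Type*} [Ring A₀] [Algebra ℚ A₀] {Z : Subalgebra ℚ A₀} [Module.Finite ℚ Z]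
    (hZ : ∀ a b : Z, a * b = b * a) (f : Z →ₐ[ℚ] Matrix ι₁ ι₁ ℚ) {𝒜 : Set (Matrix ι₁ ι₁ ℚ)} (h𝒜 : 𝒜 ⊆ Set.range f)
    {x : ι₁ → ℂ} (hx0 : x ≠ 0) {τ : ℂ}
    (hGal : ∀ σ : ℂ ≃+* ℂ, (∀ A ∈ 𝒜, ∀ μ : ℂ, A.map ((↑) : ℚ → ℂ) *ᵥ x = μ • x → σ μ = μ) → σ τ = τ) :
    ∃ y : ι₁ → ℂ, y ≠ 0 ∧ ∃ χ : Z →ₐ[ℚ] ℂ, (∀ c, (f c).map ((↑) : ℚ → ℂ) *ᵥ y = χ c • y) ∧ τ ∈ χ.range := by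
  classical
  -- the joint eigenspace of `𝒜` through `x`
  let U : Submodule ℂ (ι₁ → ℂ) :=
    { carrier := {y | ∀ A ∈ 𝒜, ∀ μ : ℂ, A.map ((↑) : ℚ → ℂ) *ᵥ x = μ • x → A.map ((↑) : ℚ → ℂ) *ᵥ y = μ • y}
      add_mem' := fun {y y'} hy hy' A hA μ hμ ↦ by
        rw [Matrix.mulVec_add, hy A hA μ hμ, hy' A hA μ hμ, smul_add]
      zero_mem' := fun A _ μ _ ↦ by rw [Matrix.mulVec_zero, smul_zero]
      smul_mem' := fun c y hy A hA μ hμ ↦ by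
        change A.map ((↑) : ℚ → ℂ) *ᵥ (c • y) = μ • (c • y)
        rw [Matrix.mulVec_smul, hy A hA μ hμ, smul_comm] }
  have hxU : x ∈ U := fun A _ μ hμ ↦ hμ
  -- `f c` commutes with `𝒜 ⊆ f(Z)`, so it preserves `U`
  have hfc : ∀ c d : Z, (f d).map ((↑) : ℚ → ℂ) * (f c).map ((↑) : ℚ → ℂ) =
      (f c).map ((↑) : ℚ → ℂ) * (f d).map ((↑) : ℚ → ℂ) := fun c d ↦ by
    rw [← map_ratCast_mul₄₄, ← map_ratCast_mul₄₄, ← map_mul, ← map_mul, hZ]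
  have hfU : ∀ (c : Z), ∀ y ∈ U, (f c).map ((↑) : ℚ → ℂ) *ᵥ y ∈ U := by
    intro c y hy A hA μ hμ
    obtain ⟨d, rfl⟩ := h𝒜 hA
    rw [Matrix.mulVec_mulVec, hfc, ← Matrix.mulVec_mulVec, hy _ hA μ hμ, Matrix.mulVec_smul]
  haveI : Nontrivial U := ⟨⟨⟨x, hxU⟩, 0, fun h ↦ hx0 (congrArg Subtype.val h)⟩⟩
  -- a common eigenvector of the commuting family of restrictions
  let T : Z → Module.End ℂ U := fun c ↦ (Matrix.toLin' ((f c).map ((↑) : ℚ → ℂ))).restrict (hfU c)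
  obtain ⟨u, hu0, hu⟩ := exists_ne_zero_forall_apply_eq_smul_of_commute T fun c d ↦ by
    refine LinearMap.ext fun w ↦ Subtype.ext ?_
    simp only [T, Module.End.mul_apply, LinearMap.restrict_apply, Matrix.toLin'_apply, Matrix.mulVec_mulVec, hfc]
  set y : ι₁ → ℂ := (u : ι₁ → ℂ) with hy_def
  have hy0 : y ≠ 0 := fun h ↦ hu0 (Subtype.ext h)
  have hev : ∀ c, ∃ a : ℂ, (f c).map ((↑) : ℚ → ℂ) *ᵥ y = a • y := fun c ↦ by
    obtain ⟨a, ha⟩ := hu c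
    refine ⟨a, ?_⟩
    have h := congrArg Subtype.val ha
    simpa only [T, LinearMap.restrict_apply, Matrix.toLin'_apply, Submodule.coe_smul] using h
  -- the eigencharacter
  obtain ⟨i₀, hi₀⟩ : ∃ i, y i ≠ 0 := Function.ne_iff.1 hy0
  have huniq : ∀ a b : ℂ, a • y = b • y → a = b := fun a b h ↦ by
    have h' := congrFun h i₀
    simp only [Pi.smul_apply, smul_eq_mul] at h'
    exact mul_right_cancel₀ hi₀ h'
  let χ₀ : Z → ℂ := fun c ↦ ((f c).map ((↑) : ℚ → ℂ) *ᵥ y) i₀ / y i₀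
  have hχ₀ : ∀ c, (f c).map ((↑) : ℚ → ℂ) *ᵥ y = χ₀ c • y := fun c ↦ by
    obtain ⟨a, ha⟩ := hev c
    have : χ₀ c = a := by
      simp only [χ₀, ha, Pi.smul_apply, smul_eq_mul]
      field_simp
    rw [this, ha]
  let χr : Z →+* ℂ :=
    { toFun := χ₀
      map_one' := huniq _ _ (by
        rw [← hχ₀, map_one, Matrix.map_one _ Rat.cast_zero Rat.cast_one, Matrix.one_mulVec, one_smul])
      map_mul' := fun c d ↦ huniq _ _ (by
        rw [← hχ₀, map_mul, map_ratCast_mul₄₄, ← Matrix.mulVec_mulVec, hχ₀ d, Matrix.mulVec_smul, hχ₀ c, smul_smul,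
          mul_comm])
      map_zero' := huniq _ _ (by
        rw [← hχ₀, map_zero, Matrix.map_zero _ Rat.cast_zero, Matrix.zero_mulVec, zero_smul])
      map_add' := fun c d ↦ huniq _ _ (by
        rw [← hχ₀, map_add, Matrix.map_add _ Rat.cast_add, Matrix.add_mulVec, hχ₀, hχ₀, add_smul]) }
  let χ : Z →ₐ[ℚ] ℂ := χr.toRatAlgHom
  have hχ : ∀ c, (f c).map ((↑) : ℚ → ℂ) *ᵥ y = χ c • y := fun c ↦ by
    rw [hχ₀ c]; rfl
  refine ⟨y, hy0, χ, hχ, ?_⟩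
  -- the field `K = ℚ(χ(Z))`, finite over `ℚ`
  let b := Module.finBasis ℚ Z
  let K : IntermediateField ℚ ℂ := IntermediateField.adjoin ℚ (Set.range fun i ↦ χ (b i))
  have hint : ∀ z ∈ Set.range (fun i ↦ χ (b i)), IsIntegral ℚ z := by
    rintro _ ⟨i, rfl⟩
    exact (Algebra.IsIntegral.isIntegral (R := ℚ) (b i)).map χ
  haveI : FiniteDimensional ℚ K := IntermediateField.finiteDimensional_adjoin hint
  have hχK : ∀ c, χ c ∈ K := by
    intro c
    have hc : c ∈ Submodule.span ℚ (Set.range b) := by rw [b.span_eq]; exact Submodule.mem_top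
    refine Submodule.span_induction (p := fun c _ ↦ χ c ∈ K) ?_ ?_ ?_ ?_ hc
    · rintro _ ⟨i, rfl⟩
      exact IntermediateField.subset_adjoin ℚ _ ⟨i, rfl⟩
    · rw [map_zero]; exact K.zero_mem
    · intro c d _ _ hc hd
      rw [map_add]; exact K.add_mem hc hd
    · intro q c _ hc
      rw [map_smul, Algebra.smul_def]
      exact K.mul_mem (algebraMap_mem K q) hc
  -- every `σ ∈ Aut(ℂ/K)` fixes `τ`
  have hτK : τ ∈ K := by
    refine Complex.mem_of_forall_mem_fixingSubgroup K fun σ hσ ↦ ?_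
    rw [IntermediateField.mem_fixingSubgroup_iff] at hσ
    have h := hGal (σ : ℂ ≃+* ℂ) fun A hA μ hμ ↦ ?_
    · simpa using h
    · obtain ⟨c, hc⟩ := h𝒜 hA
      have hμ' : μ = χ c := by
        refine huniq _ _ ?_
        rw [← hχ c, hc]
        exact (u.2 A hA μ hμ).symm
      rw [hμ']
      simpa using hσ (χ c) (hχK c)
  -- `K = ℚ[χ(b)] ⊆ χ(Z)` (the generators are algebraic)
  have hKalg : K.toSubalgebra = Algebra.adjoin ℚ (Set.range fun i ↦ χ (b i)) :=
    IntermediateField.adjoin_toSubalgebra_of_isAlgebraic fun z hz ↦ (hint z hz).isAlgebraic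
  have hle : Algebra.adjoin ℚ (Set.range fun i ↦ χ (b i)) ≤ χ.range :=
    Algebra.adjoin_le (by rintro _ ⟨i, rfl⟩; exact ⟨b i, rfl⟩)
  have hτ' : τ ∈ K.toSubalgebra := hτK
  rw [hKalg] at hτ'
  exact hle hτ'

end Extraction

/-! ### §2 The CM line of `E_τ`: the integer matrix of «multiplication by `Dτ`», its eigenlines, the Galois sign -/

section CMLine

variable {τ : ℂ}

/-- `End(E_τ) ≠ ℤ` ⟹ `Dτ² + Pτ + Q = 0` for integers `D ≠ 0`, `P`, `Q`. [cite: SilvermanAEC2009, Ch. VI Thm. 5.5]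
[cite: Lange2023AbelianVarietiesComplex, §2.1.1 Example 2.1.3] -/
private theorem exists_int_quadratic₄₄ (hτ : τ.im ≠ 0) (hCM : ellipticEnd hτ ≠ ⊥) :
    ∃ D P Q : ℤ, D ≠ 0 ∧ (D : ℂ) * τ ^ 2 + P * τ + Q = 0 := by
  obtain ⟨p, q, h⟩ := (ellipticEnd_ne_bot_iff hτ).1 hCM
  have hp : ((p.den : ℕ) : ℂ) * (p : ℂ) = (p.num : ℂ) := by exact_mod_cast Rat.den_mul_eq_num p
  have hq : ((q.den : ℕ) : ℂ) * (q : ℂ) = (q.num : ℂ) := by exact_mod_cast Rat.den_mul_eq_num q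
  refine ⟨(p.den : ℤ) * q.den, p.num * q.den, q.num * p.den,
    mul_ne_zero (Nat.cast_ne_zero.2 p.den_nz) (Nat.cast_ne_zero.2 q.den_nz), ?_⟩
  push_cast
  linear_combination ((p.den : ℂ) * (q.den : ℂ)) * h + (-((q.den : ℂ) * τ)) * hp + (-(p.den : ℂ)) * hq

variable (hτ : τ.im ≠ 0) {D P Q : ℤ}

/-- The integer matrix `(−P D; −Q 0)` is «multiplication by `Dτ`» on `Λ_τ = ℤτ ⊕ ℤ` (`Dτ·τ = −Pτ − Q`, `Dτ·1 = Dτ`), an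
endomorphism of `E_τ`; its rational representation lies in `End⁰(E_τ)`. [cite: Lange2023AbelianVarietiesComplex, §1.1.2 Prop. 1.1.6 and §2.1.1 Example 2.1.3]
[cite: SilvermanAEC2009, Ch. VI Thm. 5.5 (proof)] -/
private theorem cmMatrix_mem_endAlgRat₄₄ (h : (D : ℂ) * τ ^ 2 + P * τ + Q = 0) :
    (!![-P, D; -Q, 0] : Matrix (Fin 2) (Fin 2) ℤ).map ((↑) : ℤ → ℚ) ∈ endAlgRat (ellipticPeriod hτ) := by
  refine (mem_endRingInt_iff (ellipticPeriod hτ)).1 (mem_endRingInt_of_eq_mul hτ (α := (D : ℂ) * τ) fun x ↦ ?_)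
  simp only [ellipticPeriod_apply, Matrix.mulVec, dotProduct, Fin.sum_univ_two, Matrix.map_apply, Matrix.of_apply,
    Matrix.cons_val', Matrix.cons_val_zero, Matrix.cons_val_one, Matrix.cons_val_fin_one, Matrix.empty_val']
  push_cast
  linear_combination (-((x 0 : ℝ) : ℂ)) * h

omit hτ in
/-- Its complexification is `(−P D; −Q 0) ∈ M₂(ℂ)`. [folklore] -/
private theorem cmMatrix_map₄₄ :
    ((!![-P, D; -Q, 0] : Matrix (Fin 2) (Fin 2) ℤ).map ((↑) : ℤ → ℚ)).map ((↑) : ℚ → ℂ) = !![(-P : ℂ), D; -Q, 0] := by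
  ext i j
  fin_cases i <;> fin_cases j <;> simp

/-- The eigenline `e₊ = (D, Dτ + P)` of `(−P D; −Q 0)`, eigenvalue `Dτ`. [cite: Lange2023AbelianVarietiesComplex, §7.2.3 Prop. 7.2.6 (proof)] -/
private theorem cmMatrix_mulVec_eP₄₄ (h : (D : ℂ) * τ ^ 2 + P * τ + Q = 0) :
    (!![(-P : ℂ), D; -Q, 0] : Matrix (Fin 2) (Fin 2) ℂ) *ᵥ ![(D : ℂ), D * τ + P] = ((D : ℂ) * τ) • ![(D : ℂ), D * τ + P] := by
  funext i
  fin_cases i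
  · simp [Matrix.mulVec, dotProduct, Fin.sum_univ_two]
    ring
  · simp [Matrix.mulVec, dotProduct, Fin.sum_univ_two]
    linear_combination (-(D : ℂ)) * h

/-- The eigenline `e₋ = (D, −Dτ)` of `(−P D; −Q 0)`, eigenvalue `−Dτ − P` (the conjugate root). [cite: Lange2023AbelianVarietiesComplex, §7.2.3 Prop. 7.2.6 (proof)] -/
private theorem cmMatrix_mulVec_eM₄₄ (h : (D : ℂ) * τ ^ 2 + P * τ + Q = 0) :
    (!![(-P : ℂ), D; -Q, 0] : Matrix (Fin 2) (Fin 2) ℂ) *ᵥ ![(D : ℂ), -(D * τ)] =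
      (-((D : ℂ) * τ) - P) • ![(D : ℂ), -(D * τ)] := by
  funext i
  fin_cases i
  · simp [Matrix.mulVec, dotProduct, Fin.sum_univ_two]
    ring
  · simp [Matrix.mulVec, dotProduct, Fin.sum_univ_two]
    linear_combination (D : ℂ) * h

omit hτ in
/-- **The sign.** `σ ∈ Aut(ℂ)` maps `τ` to a root of `DT² + PT + Q`, so it fixes both eigenlines or swaps them.
[cite: MoonenZarhin1999LowDim, §3 (3.7)–(3.8)] -/
private theorem comp_eP_eM₄₄ (h : (D : ℂ) * τ ^ 2 + P * τ + Q = 0) (σ : ℂ ≃+* ℂ) :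
    ((σ : ℂ → ℂ) ∘ ![(D : ℂ), D * τ + P] = ![(D : ℂ), D * τ + P] ∧
        (σ : ℂ → ℂ) ∘ ![(D : ℂ), -(D * τ)] = ![(D : ℂ), -(D * τ)]) ∨
      ((σ : ℂ → ℂ) ∘ ![(D : ℂ), D * τ + P] = ![(D : ℂ), -(D * τ)] ∧
        (σ : ℂ → ℂ) ∘ ![(D : ℂ), -(D * τ)] = ![(D : ℂ), D * τ + P]) := by
  have hσ : (D : ℂ) * σ τ ^ 2 + P * σ τ + Q = 0 := by
    have := congrArg σ h
    simpa [map_add, map_mul, map_pow] using this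
  have key : (σ τ - τ) * ((D : ℂ) * (σ τ + τ) + P) = 0 := by linear_combination hσ - h
  rcases mul_eq_zero.1 key with h1 | h2
  · rw [sub_eq_zero] at h1
    left
    constructor <;> (funext i; fin_cases i <;> simp [h1])
  · right
    constructor
    · funext i; fin_cases i
      · simp
      · show σ ((D : ℂ) * τ + P) = -((D : ℂ) * τ)
        rw [map_add, map_mul, map_intCast, map_intCast]
        linear_combination h2
    · funext i; fin_cases i
      · simp
      · show σ (-((D : ℂ) * τ)) = (D : ℂ) * τ + P
        rw [map_neg, map_mul, map_intCast]
        linear_combination (-1 : ℂ) * h2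

omit hτ in
/-- **A matrix commuting with `(−P D; −Q 0)` (`D ≠ 0`) is `a + b(−P D; −Q 0)`** («the centralizer of `T` is `T` itself»), hence
acts on `e₊`, `e₋` by `a + bDτ`, `a + b(−Dτ − P)`, and has trace `2a − bP`. [cite: Lange2023AbelianVarietiesComplex, §7.2.3 Prop. 7.2.6 (proof)] -/
private theorem exists_eq_smul_of_comm₄₄ (hD : D ≠ 0) (h : (D : ℂ) * τ ^ 2 + P * τ + Q = 0) {M : Matrix (Fin 2) (Fin 2) ℂ}
    (hM : M * !![(-P : ℂ), D; -Q, 0] = !![(-P : ℂ), D; -Q, 0] * M) :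
    ∃ a b : ℂ, M *ᵥ ![(D : ℂ), D * τ + P] = (a + b * (D * τ)) • ![(D : ℂ), D * τ + P] ∧
      M *ᵥ ![(D : ℂ), -(D * τ)] = (a + b * (-(D * τ) - P)) • ![(D : ℂ), -(D * τ)] ∧ M.trace = 2 * a - b * P := by
  have hD' : (!![(-P : ℂ), D; -Q, 0] : Matrix (Fin 2) (Fin 2) ℂ) 0 1 ≠ 0 := by
    simpa using (Int.cast_ne_zero (α := ℂ)).2 hD
  obtain ⟨a, b, hMeq⟩ : ∃ a b : ℂ, M = a • (1 : Matrix (Fin 2) (Fin 2) ℂ) + b • !![(-P : ℂ), D; -Q, 0] :=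
    ⟨_, _, eq_smul_one_add_smul_of_mul_eq_mul hD' hM⟩
  refine ⟨a, b, ?_, ?_, ?_⟩
  · rw [hMeq, Matrix.add_mulVec, Matrix.smul_mulVec, Matrix.smul_mulVec, Matrix.one_mulVec,
      cmMatrix_mulVec_eP₄₄ h, smul_smul, ← add_smul]
  · rw [hMeq, Matrix.add_mulVec, Matrix.smul_mulVec, Matrix.smul_mulVec, Matrix.one_mulVec,
      cmMatrix_mulVec_eM₄₄ h, smul_smul, ← add_smul]
  · rw [hMeq, Matrix.trace_add, Matrix.trace_smul, Matrix.trace_smul, Matrix.trace_one, Fintype.card_fin,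
      Matrix.trace_fin_two_of]
    simp only [smul_eq_mul, Nat.cast_ofNat, add_zero]
    ring

end CMLine

/-! ### §3 The Hodge set-up: `S = R(Hg(X × E)(ℂ))`, block form, finite kernel, non-degeneracy, the `X`-blocks -/

section Hodge

variable {ι₁ : Type*} [Fintype ι₁] [DecidableEq ι₁] {E₁ : Type*} [NormedAddCommGroup E₁] [NormedSpace ℂ E₁]
  {Φ₁ : (ι₁ → ℝ) ≃L[ℝ] E₁} {η₁ : E₁ [⋀^Fin 2]→L[ℝ] ℝ} {τ : ℂ} (hτ : τ.im ≠ 0) {D P Q : ℤ}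

/-- **Block form on `Lie R(Hg(X × E)(ℂ))`.**  Every `H ∈ Lie S ⊆ Lie Hg(X × E)(ℂ)` is `(H₁₁ 0; 0 H₂₂)` with
`H₂₂ ∈ Lie Hg(E)(ℂ) = 𝒜(E) ⊗ ℂ`; since `𝒜(E)` commutes with `End⁰(E) ∋ (−P D; −Q 0)` and is trace-free, so is `H₂₂`.
[cite: MoonenZarhin1999LowDim, §3 (3.1) and Prop. (3.8)] [cite: Lange2023AbelianVarietiesComplex, §7.2.2 Prop. 7.2.5] -/
private theorem toBlocks_of_mem_lieAlgebraGL_radical₄₄ (h : (D : ℂ) * τ ^ 2 + P * τ + Q = 0)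
    {H : Matrix (ι₁ ⊕ Fin 2) (ι₁ ⊕ Fin 2) ℂ}
    (hH : H ∈ lieAlgebraGL (radical ((hodgeGroupC (prodPeriod Φ₁ (ellipticPeriod hτ))).map Matrix.SpecialLinearGroup.toGL))) :
    H = fromBlocks H.toBlocks₁₁ 0 0 H.toBlocks₂₂ ∧
      H.toBlocks₂₂ * !![(-P : ℂ), D; -Q, 0] = !![(-P : ℂ), D; -Q, 0] * H.toBlocks₂₂ ∧ H.toBlocks₂₂.trace = 0 := by
  obtain ⟨hHeq, -, h22⟩ := eq_fromBlocks_of_mem_lieAlgebraGL_hodgeGroupC_prod Φ₁ (ellipticPeriod hτ)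
    (lieAlgebraGL_mono (radical_le _) hH)
  have h22' : H.toBlocks₂₂ ∈ Submodule.span ℂ ((fun A : Matrix (Fin 2) (Fin 2) ℚ ↦ A.map ((↑) : ℚ → ℂ)) ''
      (hodgeGroupLieRat (ellipticPeriod hτ) : Set (Matrix (Fin 2) (Fin 2) ℚ))) := by
    rw [← SetLike.mem_coe, ← coe_lieAlgebraGL_hodgeGroupC_eq_span_hodgeGroupLieRat (ellipticPeriod hτ)]
    exact h22
  refine ⟨hHeq, ?_⟩
  rw [← cmMatrix_map₄₄ (D := D) (P := P) (Q := Q)]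
  have hA₀ := cmMatrix_mem_endAlgRat₄₄ hτ h
  refine Submodule.span_induction
    (p := fun M _ ↦ M * ((!![-P, D; -Q, 0] : Matrix (Fin 2) (Fin 2) ℤ).map ((↑) : ℤ → ℚ)).map ((↑) : ℚ → ℂ) =
      ((!![-P, D; -Q, 0] : Matrix (Fin 2) (Fin 2) ℤ).map ((↑) : ℤ → ℚ)).map ((↑) : ℚ → ℂ) * M ∧ M.trace = 0)
    ?_ ?_ ?_ ?_ h22'
  · rintro _ ⟨W, hW, rfl⟩
    exact ⟨by rw [← map_ratCast_mul₄₄, ← map_ratCast_mul₄₄, mul_comm_of_mem_hodgeGroupLieRat_of_mem_endAlgRat hW hA₀],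
      by rw [trace_map_ratCast₄₄, trace_eq_zero_of_mem_hodgeGroupLieRat hW, Rat.cast_zero]⟩
  · exact ⟨by rw [zero_mul, mul_zero], Matrix.trace_zero _ _⟩
  · intro M M' _ _ hM hM'
    exact ⟨by rw [add_mul, mul_add, hM.1, hM'.1], by rw [Matrix.trace_add, hM.2, hM'.2, add_zero]⟩
  · intro c M _ hM
    exact ⟨by rw [smul_mul_assoc, mul_smul_comm, hM.1], by rw [Matrix.trace_smul, hM.2, smul_zero]⟩

/-- **Opposite eigenvalues.**  `H ∈ Lie S` acts on `(0, e₊)` and `(0, e₋)` by `μ` and `−μ` (`H₂₂ = a + b(−P D; −Q 0)` with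
`2a − bP = tr H₂₂ = 0`). [cite: MoonenZarhin1999LowDim, §3 Prop. (3.8) ("`Hg(E)` is the rank 1 torus `U_k`")]
[cite: Lange2023AbelianVarietiesComplex, §7.2.3 Prop. 7.2.6] -/
private theorem exists_mulVec_eP_eM₄₄ (hD : D ≠ 0) (h : (D : ℂ) * τ ^ 2 + P * τ + Q = 0)
    {H : Matrix (ι₁ ⊕ Fin 2) (ι₁ ⊕ Fin 2) ℂ}
    (hH : H ∈ lieAlgebraGL (radical ((hodgeGroupC (prodPeriod Φ₁ (ellipticPeriod hτ))).map Matrix.SpecialLinearGroup.toGL))) :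
    ∃ μ : ℂ, H *ᵥ Sum.elim (0 : ι₁ → ℂ) ![(D : ℂ), D * τ + P] = μ • Sum.elim (0 : ι₁ → ℂ) ![(D : ℂ), D * τ + P] ∧
      H *ᵥ Sum.elim (0 : ι₁ → ℂ) ![(D : ℂ), -(D * τ)] = -(μ • Sum.elim (0 : ι₁ → ℂ) ![(D : ℂ), -(D * τ)]) := by
  obtain ⟨hHeq, hcomm, htr⟩ := toBlocks_of_mem_lieAlgebraGL_radical₄₄ hτ h hH
  obtain ⟨a, b, hPv, hMv, htr'⟩ := exists_eq_smul_of_comm₄₄ hD h hcomm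
  have h2 : (2 : ℂ) * a - b * P = 0 := by rw [← htr']; exact htr
  have hc : a + b * (-((D : ℂ) * τ) - P) = -(a + b * (D * τ)) := by linear_combination h2
  refine ⟨a + b * (D * τ), ?_, ?_⟩
  · rw [hHeq, fromBlocks_mulVec_elim_zero₄₄, hPv, smul_elim_zero₄₄]
  · rw [hHeq, fromBlocks_mulVec_elim_zero₄₄, hMv, hc, neg_smul, smul_elim_zero₄₄, neg_elim_zero₄₄]

/-- **Finite kernel.**  For `X` polarised, `E = E_τ` with complex multiplication and `Hg(X × E) ≠ Hg(X) × Hg(E)`: an `H ∈ Lie S`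
killing every joint eigenvector of `Lie S` with non-zero `X`-component vanishes — its `X`-rows vanish on a common eigenbasis
(Springer 4.4.13), so its `E`-block lies in `Lie K₂`, and `K₂° = 1` («a homomorphism `U_k → U_{F_1} × ⋯ × U_{F_n}` with finite
kernel»). [cite: MoonenZarhin1999LowDim, §3 Lemma (3.6) and Prop. (3.8) (p0007 L69–L71)] [cite: Springer1998, 4.4.13] -/
private theorem eq_zero_of_forall_jointEigenvector₄₄ (hη₁ : IsRiemannForm Φ₁ η₁) (hCM : ellipticEnd hτ ≠ ⊥)
    (hne : hodgeGroupC (prodPeriod Φ₁ (ellipticPeriod hτ)) ≠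
      blockDiagProd (hodgeGroupC Φ₁) (hodgeGroupC (ellipticPeriod hτ)))
    {H : Matrix (ι₁ ⊕ Fin 2) (ι₁ ⊕ Fin 2) ℂ}
    (hH : H ∈ lieAlgebraGL (radical ((hodgeGroupC (prodPeriod Φ₁ (ellipticPeriod hτ))).map Matrix.SpecialLinearGroup.toGL)))
    (hHw : ∀ w : ι₁ ⊕ Fin 2 → ℂ, w ≠ 0 →
      (fromBlocks 1 0 0 0 : Matrix (ι₁ ⊕ Fin 2) (ι₁ ⊕ Fin 2) ℚ).map ((↑) : ℚ → ℂ) *ᵥ w ≠ 0 →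
        (∀ H' ∈ lieAlgebraGL (radical ((hodgeGroupC (prodPeriod Φ₁ (ellipticPeriod hτ))).map
          Matrix.SpecialLinearGroup.toGL)), ∃ μ : ℂ, H' *ᵥ w = μ • w) → H *ᵥ w = 0) :
    H = 0 := by
  classical
  obtain ⟨ω, hω⟩ := IsAbelianVariety.prod ⟨η₁, hη₁⟩ (isAbelianVariety_ellipticPeriod hτ)
  have hT : IsTorusSubgroup (radical ((hodgeGroupC (prodPeriod Φ₁ (ellipticPeriod hτ))).map Matrix.SpecialLinearGroup.toGL)) :=
    hω.isTorusSubgroup_radical_map_toGL_hodgeGroupC.1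
  have hSG := lieAlgebraGL_mono
    (radical_le ((hodgeGroupC (prodPeriod Φ₁ (ellipticPeriod hτ))).map Matrix.SpecialLinearGroup.toGL))
  obtain ⟨g, -, hg⟩ := hT.exists_conj_forall_mulVec_eq_smul
  have hPmC : (fromBlocks 1 0 0 0 : Matrix (ι₁ ⊕ Fin 2) (ι₁ ⊕ Fin 2) ℚ).map ((↑) : ℚ → ℂ) = fromBlocks 1 0 0 0 := by
    rw [Matrix.fromBlocks_map, Matrix.map_one _ Rat.cast_zero Rat.cast_one, Matrix.map_zero _ Rat.cast_zero,
      Matrix.map_zero _ Rat.cast_zero, Matrix.map_zero _ Rat.cast_zero]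
  rw [hPmC] at hHw
  -- `(1 0; 0 0) H` kills the common eigenbasis `g⁻¹ e_a`
  have hcol : ∀ a, ((fromBlocks 1 0 0 0 : Matrix (ι₁ ⊕ Fin 2) (ι₁ ⊕ Fin 2) ℂ) * H) *ᵥ
      (((g⁻¹ : GL (ι₁ ⊕ Fin 2) ℂ) : Matrix (ι₁ ⊕ Fin 2) (ι₁ ⊕ Fin 2) ℂ) *ᵥ Pi.single a 1) = 0 := by
    intro a
    have hw0 : ((g⁻¹ : GL (ι₁ ⊕ Fin 2) ℂ) : Matrix (ι₁ ⊕ Fin 2) (ι₁ ⊕ Fin 2) ℂ) *ᵥ Pi.single a 1 ≠ 0 := by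
      intro h0
      have h1 : ((g : GL (ι₁ ⊕ Fin 2) ℂ) : Matrix (ι₁ ⊕ Fin 2) (ι₁ ⊕ Fin 2) ℂ) *ᵥ
          (((g⁻¹ : GL (ι₁ ⊕ Fin 2) ℂ) : Matrix (ι₁ ⊕ Fin 2) (ι₁ ⊕ Fin 2) ℂ) *ᵥ Pi.single a 1) = Pi.single a 1 := by
        rw [Matrix.mulVec_mulVec, Units.mul_inv, Matrix.one_mulVec]
      rw [h0, Matrix.mulVec_zero] at h1
      have h2 := congrFun h1 a
      rw [Pi.zero_apply, Pi.single_eq_same] at h2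
      exact zero_ne_one h2
    have hwj : ∀ H' ∈ lieAlgebraGL (radical ((hodgeGroupC (prodPeriod Φ₁ (ellipticPeriod hτ))).map
        Matrix.SpecialLinearGroup.toGL)), ∃ μ : ℂ,
        H' *ᵥ (((g⁻¹ : GL (ι₁ ⊕ Fin 2) ℂ) : Matrix (ι₁ ⊕ Fin 2) (ι₁ ⊕ Fin 2) ℂ) *ᵥ Pi.single a 1) =
          μ • (((g⁻¹ : GL (ι₁ ⊕ Fin 2) ℂ) : Matrix (ι₁ ⊕ Fin 2) (ι₁ ⊕ Fin 2) ℂ) *ᵥ Pi.single a 1) :=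
      fun H' hH' ↦ ⟨_, hg H' hH' a⟩
    by_cases hPw : (fromBlocks 1 0 0 0 : Matrix (ι₁ ⊕ Fin 2) (ι₁ ⊕ Fin 2) ℂ) *ᵥ
        (((g⁻¹ : GL (ι₁ ⊕ Fin 2) ℂ) : Matrix (ι₁ ⊕ Fin 2) (ι₁ ⊕ Fin 2) ℂ) *ᵥ Pi.single a 1) = 0
    · obtain ⟨μ, hμ⟩ := hwj H hH
      rw [← Matrix.mulVec_mulVec, hμ, Matrix.mulVec_smul, hPw, smul_zero]
    · rw [← Matrix.mulVec_mulVec, hHw _ hw0 hPw hwj, Matrix.mulVec_zero]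
  have hPH : (fromBlocks 1 0 0 0 : Matrix (ι₁ ⊕ Fin 2) (ι₁ ⊕ Fin 2) ℂ) * H = 0 := by
    have h1 : (fromBlocks 1 0 0 0 : Matrix (ι₁ ⊕ Fin 2) (ι₁ ⊕ Fin 2) ℂ) * H *
        ((g⁻¹ : GL (ι₁ ⊕ Fin 2) ℂ) : Matrix (ι₁ ⊕ Fin 2) (ι₁ ⊕ Fin 2) ℂ) = 0 := by
      ext i a
      have h := congrFun (hcol a) i
      rw [Matrix.mulVec_mulVec, Matrix.mulVec_single_one] at h
      exact h
    calc (fromBlocks 1 0 0 0 : Matrix (ι₁ ⊕ Fin 2) (ι₁ ⊕ Fin 2) ℂ) * H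
        = (fromBlocks 1 0 0 0 : Matrix (ι₁ ⊕ Fin 2) (ι₁ ⊕ Fin 2) ℂ) * H *
            ((g⁻¹ : GL (ι₁ ⊕ Fin 2) ℂ) : Matrix (ι₁ ⊕ Fin 2) (ι₁ ⊕ Fin 2) ℂ) *
            ((g : GL (ι₁ ⊕ Fin 2) ℂ) : Matrix (ι₁ ⊕ Fin 2) (ι₁ ⊕ Fin 2) ℂ) := by
          rw [Matrix.mul_assoc ((fromBlocks 1 0 0 0 : Matrix (ι₁ ⊕ Fin 2) (ι₁ ⊕ Fin 2) ℂ) * H), Units.inv_mul,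
            Matrix.mul_one]
      _ = 0 := by rw [h1, Matrix.zero_mul]
  -- the `X`-rows of `H` vanish; its `E`-block lies in `Lie K₂ = Lie K₂° = 0`
  obtain ⟨hHeq, -, -⟩ := eq_fromBlocks_of_mem_lieAlgebraGL_hodgeGroupC_prod Φ₁ (ellipticPeriod hτ) (hSG hH)
  have h11 : H.toBlocks₁₁ = 0 := by
    rw [hHeq, Matrix.fromBlocks_multiply] at hPH
    simp only [Matrix.one_mul, Matrix.zero_mul, Matrix.mul_zero, add_zero] at hPH
    rw [← Matrix.fromBlocks_zero, Matrix.fromBlocks_inj] at hPH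
    exact hPH.1
  have hK0 : identityComponent ((hodgeGroupCProdInr Φ₁ (ellipticPeriod hτ)).map Matrix.SpecialLinearGroup.toGL) = ⊥ := by
    rcases identityComponent_hodgeGroupCProdInr_eq_bot_or_eq_of_almostQSimple Φ₁ (ellipticPeriod hτ)
        (forall_eq_bot_or_eq_of_finrank_hodgeGroupLieRat_eq_one (ellipticPeriod hτ)
          (finrank_hodgeGroupLieRat_ellipticPeriod_of_ne_bot hτ hCM)) with h | h
    · exact h
    · exact absurd (hodgeGroupC_prod_eq_blockDiagProd_of_hodgeGroupCProdInr_eq Φ₁ (ellipticPeriod hτ) h) hne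
  have h22 : H.toBlocks₂₂ = 0 := by
    have h := toBlocks₂₂_mem_lieAlgebraGL_hodgeGroupCProdInr Φ₁ (ellipticPeriod hτ) (hSG hH) h11
    rw [← lieAlgebraGL_identityComponent (isAlgebraicSubgroup_map_toGL_hodgeGroupCProdInr Φ₁ (ellipticPeriod hτ)), hK0,
      lieAlgebraGL_bot, Submodule.mem_bot] at h
    exact h
  rw [hHeq, h11, h22, Matrix.fromBlocks_zero]

/-- **Non-degeneracy.**  For `X` polarised, `E = E_τ` CM, `Hg(X × E) ≠ Hg(X) × Hg(E)`: some `H ∈ Lie S` moves `(0, e₊)`.  The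
trace-free `W₀ = 2(−P D; −Q 0) + P ∈ 𝒜(E)` pairs with a central `B ∈ End⁰(X) ∩ 𝒜(X)` in `(B 0; 0 W₀) ∈ 𝒜(X × E)` (g42 ★); this
element commutes with `Lie Hg(X × E)(ℂ)`, so it lies in `Lie Z(G)° = Lie R(G)`; and `W₀ e₊ = D(2Dτ + P) e₊ ≠ 0`.
[cite: MoonenZarhin1999LowDim, §3 Lemma (3.6) and Prop. (3.8)] [cite: Springer1998, 7.3.1 (i)] -/
private theorem exists_mulVec_eP_ne_zero₄₄ (hη₁ : IsRiemannForm Φ₁ η₁) (hCM : ellipticEnd hτ ≠ ⊥)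
    (hne : hodgeGroupC (prodPeriod Φ₁ (ellipticPeriod hτ)) ≠
      blockDiagProd (hodgeGroupC Φ₁) (hodgeGroupC (ellipticPeriod hτ)))
    (hD : D ≠ 0) (h : (D : ℂ) * τ ^ 2 + P * τ + Q = 0) :
    ∃ H ∈ lieAlgebraGL (radical ((hodgeGroupC (prodPeriod Φ₁ (ellipticPeriod hτ))).map Matrix.SpecialLinearGroup.toGL)),
      H *ᵥ Sum.elim (0 : ι₁ → ℂ) ![(D : ℂ), D * τ + P] ≠ 0 := by
  classical
  obtain ⟨ω, hω⟩ := IsAbelianVariety.prod ⟨η₁, hη₁⟩ (isAbelianVariety_ellipticPeriod hτ)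
  have hDC : (D : ℂ) ≠ 0 := (Int.cast_ne_zero (α := ℂ)).2 hD
  have hA₀ := cmMatrix_mem_endAlgRat₄₄ hτ h
  -- the trace-free `W₀ = 2 A₀ + P ∈ 𝒜(E)`
  have hW₀E : (2 : ℚ) • ((!![-P, D; -Q, 0] : Matrix (Fin 2) (Fin 2) ℤ).map ((↑) : ℤ → ℚ)) +
      (P : ℚ) • (1 : Matrix (Fin 2) (Fin 2) ℚ) ∈ endAlgRat (ellipticPeriod hτ) :=
    (endAlgRat _).add_mem ((endAlgRat _).smul_mem hA₀ _) ((endAlgRat _).smul_mem (Subalgebra.one_mem _) _)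
  have hW₀C : ((2 : ℚ) • ((!![-P, D; -Q, 0] : Matrix (Fin 2) (Fin 2) ℤ).map ((↑) : ℤ → ℚ)) +
      (P : ℚ) • (1 : Matrix (Fin 2) (Fin 2) ℚ)).map ((↑) : ℚ → ℂ) = !![(-P : ℂ), 2 * D; -(2 * Q), P] := by
    ext i j
    fin_cases i <;> fin_cases j <;> simp
    ring
  have hW₀tr : ((2 : ℚ) • ((!![-P, D; -Q, 0] : Matrix (Fin 2) (Fin 2) ℤ).map ((↑) : ℤ → ℚ)) +
      (P : ℚ) • (1 : Matrix (Fin 2) (Fin 2) ℚ)).trace = 0 := by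
    have h' : ((((2 : ℚ) • ((!![-P, D; -Q, 0] : Matrix (Fin 2) (Fin 2) ℤ).map ((↑) : ℤ → ℚ)) +
        (P : ℚ) • (1 : Matrix (Fin 2) (Fin 2) ℚ)).trace : ℚ) : ℂ) = 0 := by
      rw [← trace_map_ratCast₄₄, hW₀C, Matrix.trace_fin_two_of]; ring
    exact_mod_cast h'
  have hW₀ := (mem_hodgeGroupLieRat_ellipticPeriod_iff_of_ne_bot hτ hCM).2 ⟨hW₀E, hW₀tr⟩
  have hW₀0 : (2 : ℚ) • ((!![-P, D; -Q, 0] : Matrix (Fin 2) (Fin 2) ℤ).map ((↑) : ℤ → ℚ)) +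
      (P : ℚ) • (1 : Matrix (Fin 2) (Fin 2) ℚ) ≠ 0 := by
    intro h0
    have h' := congrFun (congrFun (congrArg (fun M : Matrix (Fin 2) (Fin 2) ℚ ↦ M.map ((↑) : ℚ → ℂ)) h0) 0) 1
    rw [hW₀C, Matrix.map_zero _ Rat.cast_zero] at h'
    have h'' : (2 : ℂ) * D = 0 := by simpa using h'
    exact hDC (by simpa using h'')
  -- g42 ★: a central `B ∈ End⁰(X) ∩ 𝒜(X)` with `(B 0; 0 W₀) ∈ 𝒜(X × E)`
  obtain ⟨-, hall⟩ := (hη₁.hodgeGroupC_prod_ellipticPeriod_eq_blockDiagProd_or_exists hτ hCM).resolve_left hne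
  obtain ⟨-, B, -, hBend, -, -, -, hBW⟩ := hall _ hW₀ hW₀0
  have hc₀G := (mem_hodgeGroupLieRat_iff_map_ratCast_mem_lieAlgebraGL (prodPeriod Φ₁ (ellipticPeriod hτ))).1 hBW
  -- `(B 0; 0 W₀) ⊗ 1` commutes with `Lie Hg(X × E)(ℂ) = 𝒜(X × E) ⊗ ℂ`
  have hc₀comm : ∀ W ∈ lieAlgebraGL ((hodgeGroupC (prodPeriod Φ₁ (ellipticPeriod hτ))).map Matrix.SpecialLinearGroup.toGL),
      (fromBlocks B 0 0 ((2 : ℚ) • ((!![-P, D; -Q, 0] : Matrix (Fin 2) (Fin 2) ℤ).map ((↑) : ℤ → ℚ)) +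
        (P : ℚ) • (1 : Matrix (Fin 2) (Fin 2) ℚ))).map ((↑) : ℚ → ℂ) * W =
      W * (fromBlocks B 0 0 ((2 : ℚ) • ((!![-P, D; -Q, 0] : Matrix (Fin 2) (Fin 2) ℤ).map ((↑) : ℤ → ℚ)) +
        (P : ℚ) • (1 : Matrix (Fin 2) (Fin 2) ℚ))).map ((↑) : ℚ → ℂ) := by
    intro W hW
    have hW' : W ∈ Submodule.span ℂ ((fun A : Matrix (ι₁ ⊕ Fin 2) (ι₁ ⊕ Fin 2) ℚ ↦ A.map ((↑) : ℚ → ℂ)) ''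
        (hodgeGroupLieRat (prodPeriod Φ₁ (ellipticPeriod hτ)) : Set (Matrix (ι₁ ⊕ Fin 2) (ι₁ ⊕ Fin 2) ℚ))) := by
      rw [← SetLike.mem_coe, ← coe_lieAlgebraGL_hodgeGroupC_eq_span_hodgeGroupLieRat (prodPeriod Φ₁ (ellipticPeriod hτ))]
      exact hW
    refine Submodule.span_induction
      (p := fun W _ ↦ (fromBlocks B 0 0 ((2 : ℚ) • ((!![-P, D; -Q, 0] : Matrix (Fin 2) (Fin 2) ℤ).map ((↑) : ℤ → ℚ)) +
          (P : ℚ) • (1 : Matrix (Fin 2) (Fin 2) ℚ))).map ((↑) : ℚ → ℂ) * W =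
        W * (fromBlocks B 0 0 ((2 : ℚ) • ((!![-P, D; -Q, 0] : Matrix (Fin 2) (Fin 2) ℤ).map ((↑) : ℤ → ℚ)) +
          (P : ℚ) • (1 : Matrix (Fin 2) (Fin 2) ℚ))).map ((↑) : ℚ → ℂ)) ?_ ?_ ?_ ?_ hW'
    · rintro _ ⟨A, hA, rfl⟩
      rw [← map_ratCast_mul₄₄, ← map_ratCast_mul₄₄,
        eq_fromBlocks_of_mem_hodgeGroupLieRat_prod Φ₁ (ellipticPeriod hτ) hA,
        Matrix.fromBlocks_multiply, Matrix.fromBlocks_multiply]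
      simp only [Matrix.mul_zero, Matrix.zero_mul, add_zero, zero_add]
      rw [mul_comm_of_mem_hodgeGroupLieRat_of_mem_endAlgRat (toBlocks₁₁_mem_hodgeGroupLieRat Φ₁ (ellipticPeriod hτ) hA)
          hBend,
        mul_comm_of_mem_hodgeGroupLieRat_of_mem_endAlgRat (toBlocks₂₂_mem_hodgeGroupLieRat Φ₁ (ellipticPeriod hτ) hA)
          hW₀E]
    · rw [mul_zero, zero_mul]
    · intro W W' _ _ hW hW'
      rw [mul_add, add_mul, hW, hW']
    · intro c W _ hW
      rw [mul_smul_comm, smul_mul_assoc, hW]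
  -- hence it lies in `Lie Z(G)° = Lie R(G)` (Springer 7.3.1 (i))
  have hZalg : IsAlgebraicSubgroup (((hodgeGroupC (prodPeriod Φ₁ (ellipticPeriod hτ))).map Matrix.SpecialLinearGroup.toGL) ⊓
      Subgroup.centralizer (((hodgeGroupC (prodPeriod Φ₁ (ellipticPeriod hτ))).map Matrix.SpecialLinearGroup.toGL :
        Subgroup (GL (ι₁ ⊕ Fin 2) ℂ)) : Set (GL (ι₁ ⊕ Fin 2) ℂ))) :=
    (isAlgebraicSubgroup_map_toGL_hodgeGroupC (prodPeriod Φ₁ (ellipticPeriod hτ))).inf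
      (isAlgebraicSubgroup_centralizer_set _)
  refine ⟨(fromBlocks B 0 0 ((2 : ℚ) • ((!![-P, D; -Q, 0] : Matrix (Fin 2) (Fin 2) ℤ).map ((↑) : ℤ → ℚ)) +
    (P : ℚ) • (1 : Matrix (Fin 2) (Fin 2) ℚ))).map ((↑) : ℚ → ℂ), ?_, ?_⟩
  · rw [hω.isConnectedReductive_map_toGL_hodgeGroupC.radical_eq_identityComponent_center,
      lieAlgebraGL_identityComponent hZalg]
    refine mem_lieAlgebraGL_of_forall_real_exp_smul_mem hZalg fun t ↦ ?_
    obtain ⟨g, hgG, hgexp, hgc⟩ :=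
      (isZConnected_map_toGL_hodgeGroupC (prodPeriod Φ₁ (ellipticPeriod hτ))).exists_mem_center_coe_eq_exp
        (Submodule.smul_mem _ (t : ℂ) hc₀G) (fun W hW ↦ by rw [smul_mul_assoc, mul_smul_comm, hc₀comm W hW])
    exact ⟨g, Subgroup.mem_inf.2 ⟨hgG, Subgroup.mem_centralizer_iff.2 hgc⟩, hgexp⟩
  · rw [Matrix.fromBlocks_map, Matrix.map_zero _ Rat.cast_zero, Matrix.map_zero _ Rat.cast_zero,
      fromBlocks_mulVec_elim_zero₄₄, hW₀C]
    intro h0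
    have h' := congrFun h0 (Sum.inr 0)
    simp only [Sum.elim_inr, Matrix.mulVec, dotProduct, Fin.sum_univ_two, Matrix.of_apply, Matrix.cons_val',
      Matrix.cons_val_zero, Matrix.cons_val_one, Matrix.cons_val_fin_one, Matrix.empty_val', Pi.zero_apply] at h'
    -- `h' : −P·D + 2D(Dτ + P) = 0`, i.e. `(2Dτ + P)·D = 0`; but `Im (2Dτ + P) = 2D·Im τ ≠ 0`
    have h2 : (2 * (D : ℂ) * τ + P) * D = 0 := by linear_combination h'
    rcases mul_eq_zero.1 h2 with h3 | h3
    · have h4 : D = 0 ∨ τ.im = 0 := by simpa using congrArg Complex.im h3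
      rcases h4 with h5 | h5
      · exact hD h5
      · exact hτ h5
    · exact hDC h3

/-- **The `X`-blocks of the rational points of `Lie S` are central endomorphisms of `X`.**  For `X` polarised and a rational
`A` with `A ⊗ 1 ∈ Lie S`: `A ∈ 𝒜(X × E)`, its block `A₁₁ ∈ 𝒜(X)`, and `A₁₁` commutes with `Hg(X)(ℂ)` (`S = R(G)` is central in
`G = Hg(X × E)(ℂ)`, which maps onto `Hg(X)(ℂ)`), so `A₁₁ ∈ End_ℚ(V)^{Hg(X)} = End⁰(X)` — and `𝒜(X)` commutes with `End⁰(X)`.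
[cite: Lange2023AbelianVarietiesComplex, §7.2.2 Prop. 7.2.5] [cite: Springer1998, 7.3.1 (i)] [cite: MoonenZarhin1999LowDim, §3 Prop. (3.8)] -/
private theorem toBlocks₁₁_mem_endAlgRat_of_map_mem_lieAlgebraGL_radical₄₄ (hη₁ : IsRiemannForm Φ₁ η₁)
    {A : Matrix (ι₁ ⊕ Fin 2) (ι₁ ⊕ Fin 2) ℚ}
    (hA : A.map ((↑) : ℚ → ℂ) ∈
      lieAlgebraGL (radical ((hodgeGroupC (prodPeriod Φ₁ (ellipticPeriod hτ))).map Matrix.SpecialLinearGroup.toGL))) :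
    A ∈ hodgeGroupLieRat (prodPeriod Φ₁ (ellipticPeriod hτ)) ∧ A.toBlocks₁₁ ∈ hodgeGroupLieRat Φ₁ ∧
      A.toBlocks₁₁ ∈ endAlgRat Φ₁ := by
  obtain ⟨ω, hω⟩ := IsAbelianVariety.prod ⟨η₁, hη₁⟩ (isAbelianVariety_ellipticPeriod hτ)
  have hSt := hω.isTorusSubgroup_radical_map_toGL_hodgeGroupC
  have hA𝒜 : A ∈ hodgeGroupLieRat (prodPeriod Φ₁ (ellipticPeriod hτ)) :=
    (mem_hodgeGroupLieRat_iff_map_ratCast_mem_lieAlgebraGL (prodPeriod Φ₁ (ellipticPeriod hτ))).2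
      (lieAlgebraGL_mono (radical_le _) hA)
  have hA₁₁ : A.toBlocks₁₁ ∈ hodgeGroupLieRat Φ₁ := toBlocks₁₁_mem_hodgeGroupLieRat Φ₁ (ellipticPeriod hτ) hA𝒜
  refine ⟨hA𝒜, hA₁₁, mem_endAlgRat_of_map_mem_hodgeGroupCCommutant Φ₁ ?_⟩
  rw [map_algebraMap_eq₄₄]
  refine (mem_hodgeGroupCCommutant_iff Φ₁).2 fun M₁ hM₁ ↦ ?_
  obtain ⟨M₂, -, hM⟩ := exists_blockDiagC_mem_hodgeGroupC_prod_left Φ₁ (ellipticPeriod hτ) hM₁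
  have hsG : Matrix.SpecialLinearGroup.toGL (blockDiagC ι₁ (Fin 2) (M₁, M₂)) ∈
      (hodgeGroupC (prodPeriod Φ₁ (ellipticPeriod hτ))).map Matrix.SpecialLinearGroup.toGL := ⟨_, hM, rfl⟩
  have hconj := conj_eq_self_of_mem_lieAlgebraGL_of_forall_commute
    (H := radical ((hodgeGroupC (prodPeriod Φ₁ (ellipticPeriod hτ))).map Matrix.SpecialLinearGroup.toGL))
    (s := Matrix.SpecialLinearGroup.toGL (blockDiagC ι₁ (Fin 2) (M₁, M₂)))
    (fun h hh ↦ ((Subgroup.mem_centralizer_iff.1 (hSt.2 hh)) _ hsG).symm) hA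
  have hsA : ((Matrix.SpecialLinearGroup.toGL (blockDiagC ι₁ (Fin 2) (M₁, M₂)) : GL (ι₁ ⊕ Fin 2) ℂ) :
        Matrix (ι₁ ⊕ Fin 2) (ι₁ ⊕ Fin 2) ℂ) * A.map ((↑) : ℚ → ℂ) =
      A.map ((↑) : ℚ → ℂ) * ((Matrix.SpecialLinearGroup.toGL (blockDiagC ι₁ (Fin 2) (M₁, M₂)) : GL (ι₁ ⊕ Fin 2) ℂ) :
        Matrix (ι₁ ⊕ Fin 2) (ι₁ ⊕ Fin 2) ℂ) := by
    have h := congrArg (· * ((Matrix.SpecialLinearGroup.toGL (blockDiagC ι₁ (Fin 2) (M₁, M₂)) : GL (ι₁ ⊕ Fin 2) ℂ) :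
      Matrix (ι₁ ⊕ Fin 2) (ι₁ ⊕ Fin 2) ℂ)) hconj
    simpa only [Matrix.mul_assoc, Units.inv_mul, Matrix.mul_one] using h
  have hs : ((Matrix.SpecialLinearGroup.toGL (blockDiagC ι₁ (Fin 2) (M₁, M₂)) : GL (ι₁ ⊕ Fin 2) ℂ) :
      Matrix (ι₁ ⊕ Fin 2) (ι₁ ⊕ Fin 2) ℂ) = fromBlocks (M₁ : Matrix ι₁ ι₁ ℂ) 0 0 (M₂ : Matrix (Fin 2) (Fin 2) ℂ) := rfl
  rw [hs, eq_fromBlocks_of_mem_hodgeGroupLieRat_prod Φ₁ (ellipticPeriod hτ) hA𝒜, Matrix.fromBlocks_map,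
    Matrix.fromBlocks_multiply, Matrix.fromBlocks_multiply] at hsA
  simp only [Matrix.map_zero _ Rat.cast_zero, Matrix.mul_zero, Matrix.zero_mul, add_zero, zero_add] at hsA
  exact (Matrix.fromBlocks_inj.1 hsA).1

/-! ### §4 Proposition (3.8), the CM half -/

/-- **MOONEN–ZARHIN (3.8), THE CM HALF: `Hg(X × E) ≠ Hg(X) × Hg(E)` for a CM elliptic curve `E = E_τ` forces `k = ℚ(τ) = End⁰(E)`
to EMBED INTO THE CENTRE of `End⁰(X)`** — there is a common eigenvector `y ≠ 0` of the centre `C` of `End⁰(X)` on `H₁(X, ℂ)`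
whose eigencharacter `χ : C →ₐ[ℚ] ℂ` has `τ ∈ χ(C)` (so `k = ℚ(τ) ⊆ χ(C)`, a complex embedding of a simple factor `F_i` of `C`:
«there exists an embedding `k → F_i`»).  `X` polarised by `η₁`; `Hom(E, X) = 0` is not needed in this half.
[cite: MoonenZarhin1999LowDim, §3 Prop. (3.8) (p0007 L55–L74)] [cite: Lange2023AbelianVarietiesComplex, §7.2.2 Prop. 7.2.5]
[cite: Springer1998, 7.3.1 (i)] -/
theorem IsRiemannForm.exists_eigencharacter_center_endAlgRat_of_hodgeGroupC_prod_ellipticPeriod_ne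
    (hη₁ : IsRiemannForm Φ₁ η₁) (hCM : ellipticEnd hτ ≠ ⊥)
    (hne : hodgeGroupC (prodPeriod Φ₁ (ellipticPeriod hτ)) ≠
      blockDiagProd (hodgeGroupC Φ₁) (hodgeGroupC (ellipticPeriod hτ))) :
    ∃ y : ι₁ → ℂ, y ≠ 0 ∧ ∃ χ : Subalgebra.center ℚ (endAlgRat Φ₁) →ₐ[ℚ] ℂ,
      (∀ c : Subalgebra.center ℚ (endAlgRat Φ₁),
        ((c : endAlgRat Φ₁) : Matrix ι₁ ι₁ ℚ).map ((↑) : ℚ → ℂ) *ᵥ y = χ c • y) ∧ τ ∈ χ.range := by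
  classical
  obtain ⟨ω, hω⟩ := IsAbelianVariety.prod ⟨η₁, hη₁⟩ (isAbelianVariety_ellipticPeriod hτ)
  have hSt := hω.isTorusSubgroup_radical_map_toGL_hodgeGroupC
  -- the CM data
  obtain ⟨D, P, Q, hD, hrel⟩ := exists_int_quadratic₄₄ hτ hCM
  have hDC : (D : ℂ) ≠ 0 := (Int.cast_ne_zero (α := ℂ)).2 hD
  have heP : (![(D : ℂ), D * τ + P] : Fin 2 → ℂ) ≠ 0 := fun h ↦ hDC (by simpa using congrFun h 0)
  have heM : (![(D : ℂ), -(D * τ)] : Fin 2 → ℂ) ≠ 0 := fun h ↦ hDC (by simpa using congrFun h 0)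
  -- g44-#3 on `S = R(Hg(X × E)(ℂ))` with the sign pair `(0, e₊)`, `(0, e₋)` and the `X`-projection `(1 0; 0 0)`
  obtain ⟨v, -, hPv, -, hvGal⟩ := exists_jointEigenvector_forall_ringEquiv_apply_eq hSt.1
    (isAutStableGL_radical_map_toGL_hodgeGroupC (prodPeriod Φ₁ (ellipticPeriod hτ))).map_mem
    (elim_zero_ne_zero₄₄ (ι₁ := ι₁) heP) (elim_zero_ne_zero₄₄ (ι₁ := ι₁) heM)
    (fun H hH ↦ exists_mulVec_eP_eM₄₄ hτ hD hrel hH)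
    (fun σ ↦ by
      rcases comp_eP_eM₄₄ hrel σ with ⟨h1, h2⟩ | ⟨h1, h2⟩
      · exact Or.inl ⟨by rw [comp_elim_zero₄₄, h1], by rw [comp_elim_zero₄₄, h2]⟩
      · exact Or.inr ⟨by rw [comp_elim_zero₄₄, h1], by rw [comp_elim_zero₄₄, h2]⟩)
    (fromBlocks 1 0 0 0)
    (fun H hH hHw ↦ by rw [eq_zero_of_forall_jointEigenvector₄₄ hτ hη₁ hCM hne hH hHw, Matrix.zero_mulVec])
    (exists_mulVec_eP_ne_zero₄₄ hτ hη₁ hCM hne hD hrel)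
  -- EXTRACTION.  `x = v|_X ≠ 0`
  have hx0 : v ∘ Sum.inl ≠ 0 := by
    intro h
    apply hPv
    rw [Matrix.fromBlocks_map, Matrix.fromBlocks_mulVec, h]
    funext i
    cases i <;> simp
  -- the centre `C` of `End⁰(X)`, a commutative finite `ℚ`-algebra of rational matrices
  haveI : Module.Finite ℚ (Subalgebra.center ℚ (endAlgRat Φ₁)) :=
    Module.Finite.of_injective
      ((endAlgRat Φ₁).val.comp (Subalgebra.center ℚ (endAlgRat Φ₁)).val).toLinearMap
      (Subtype.val_injective.comp Subtype.val_injective)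
  refine exists_eigencharacter₄₄ (Z := Subalgebra.center ℚ (endAlgRat Φ₁))
    (fun a b ↦ Subtype.ext (Subalgebra.mem_center_iff.1 b.2 a))
    ((endAlgRat Φ₁).val.comp (Subalgebra.center ℚ (endAlgRat Φ₁)).val)
    (𝒜 := (fun A : Matrix (ι₁ ⊕ Fin 2) (ι₁ ⊕ Fin 2) ℚ ↦ A.toBlocks₁₁) ''
      {A | A.map ((↑) : ℚ → ℂ) ∈
        lieAlgebraGL (radical ((hodgeGroupC (prodPeriod Φ₁ (ellipticPeriod hτ))).map Matrix.SpecialLinearGroup.toGL))})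
    ?_ hx0 ?_
  · -- `𝒜 ⊆ C`: the `X`-blocks are central endomorphisms (`𝒜(X)` commutes with `End⁰(X)`)
    rintro _ ⟨A, hA, rfl⟩
    obtain ⟨-, hA₁₁, hA₁₁end⟩ := toBlocks₁₁_mem_endAlgRat_of_map_mem_lieAlgebraGL_radical₄₄ hτ hη₁ hA
    have hcen : (⟨A.toBlocks₁₁, hA₁₁end⟩ : endAlgRat Φ₁) ∈ Subalgebra.center ℚ (endAlgRat Φ₁) :=
      Subalgebra.mem_center_iff.2 fun b ↦ Subtype.ext
        (mul_comm_of_mem_hodgeGroupLieRat_of_mem_endAlgRat hA₁₁ b.2).symm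
    exact ⟨⟨⟨A.toBlocks₁₁, hA₁₁end⟩, hcen⟩, rfl⟩
  · -- the Galois step: fixing the eigenvalues on `x` of the `X`-blocks fixes `e₊`, i.e. `τ`
    intro σ hσ
    have hfix := hvGal σ fun A hA μ hμ ↦ hσ (A.toBlocks₁₁) ⟨A, hA, rfl⟩ μ (by
      obtain ⟨hA𝒜, -, -⟩ := toBlocks₁₁_mem_endAlgRat_of_map_mem_lieAlgebraGL_radical₄₄ hτ hη₁ hA
      rw [eq_fromBlocks_of_mem_hodgeGroupLieRat_prod Φ₁ (ellipticPeriod hτ) hA𝒜, Matrix.fromBlocks_map,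
        Matrix.fromBlocks_mulVec] at hμ
      have h := congrArg (· ∘ Sum.inl) hμ
      simp only [Sum.elim_comp_inl, Matrix.map_zero _ Rat.cast_zero, Matrix.zero_mulVec, add_zero,
        smul_comp_inl₄₄] at h
      exact h)
    have h := congrFun hfix (Sum.inr 1)
    simp only [Function.comp_apply, Sum.elim_inr, Matrix.cons_val_one, Matrix.cons_val_fin_one, map_add, map_mul,
      map_intCast] at h
    exact mul_left_cancel₀ hDC (by linear_combination h)

/-- **The same for an abelian variety `X`** (some polarisation). [cite: MoonenZarhin1999LowDim, §3 Prop. (3.8) (p0007 L55–L74)] -/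
theorem IsAbelianVariety.exists_eigencharacter_center_endAlgRat_of_hodgeGroupC_prod_ellipticPeriod_ne
    (hX : IsAbelianVariety Φ₁) (hCM : ellipticEnd hτ ≠ ⊥)
    (hne : hodgeGroupC (prodPeriod Φ₁ (ellipticPeriod hτ)) ≠
      blockDiagProd (hodgeGroupC Φ₁) (hodgeGroupC (ellipticPeriod hτ))) :
    ∃ y : ι₁ → ℂ, y ≠ 0 ∧ ∃ χ : Subalgebra.center ℚ (endAlgRat Φ₁) →ₐ[ℚ] ℂ,
      (∀ c : Subalgebra.center ℚ (endAlgRat Φ₁),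
        ((c : endAlgRat Φ₁) : Matrix ι₁ ι₁ ℚ).map ((↑) : ℚ → ℂ) *ᵥ y = χ c • y) ∧ τ ∈ χ.range := by
  obtain ⟨η₁, hη₁⟩ := hX
  exact hη₁.exists_eigencharacter_center_endAlgRat_of_hodgeGroupC_prod_ellipticPeriod_ne hτ hCM hne

/-! ### §5 Proposition (3.8) read as a splitting criterion: a centre all of whose complex embeddings are real -/

/-- **MOONEN–ZARHIN (3.8) CONTRAPOSED: if every complex embedding of the centre `C` of `End⁰(X)` is real** (in
`C = K_1 × ⋯ × K_m × F_1 × ⋯ × F_n` there is no CM factor `F_i` to receive `k`: `n = 0`) **then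
`Hg(X × E)(ℂ) = Hg(X)(ℂ) × Hg(E)(ℂ)` for every elliptic curve `E = E_τ` with complex multiplication** (`k = ℚ(τ)`, `τ ∉ ℝ`,
cannot lie in a real image `χ(C)`). [cite: MoonenZarhin1999LowDim, §3 Prop. (3.8) (p0007 L65–L74)] -/
theorem IsRiemannForm.hodgeGroupC_prod_ellipticPeriod_eq_blockDiagProd_of_forall_im_eq_zero
    (hη₁ : IsRiemannForm Φ₁ η₁) (hCM : ellipticEnd hτ ≠ ⊥)
    (hreal : ∀ χ : Subalgebra.center ℚ (endAlgRat Φ₁) →ₐ[ℚ] ℂ, ∀ c, (χ c).im = 0) :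
    hodgeGroupC (prodPeriod Φ₁ (ellipticPeriod hτ)) = blockDiagProd (hodgeGroupC Φ₁) (hodgeGroupC (ellipticPeriod hτ)) := by
  by_contra hne
  obtain ⟨_, -, χ, -, hτχ⟩ :=
    hη₁.exists_eigencharacter_center_endAlgRat_of_hodgeGroupC_prod_ellipticPeriod_ne hτ hCM hne
  obtain ⟨c, hc⟩ := (AlgHom.mem_range χ).1 hτχ
  exact hτ (by rw [← hc]; exact hreal χ c)

/-- In particular, **if the centre of `End⁰(X)` is `ℚ`** (e.g. `End⁰(X) = ℚ`), then `Hg(X × E)(ℂ) = Hg(X)(ℂ) × Hg(E)(ℂ)` for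
every elliptic curve `E` with complex multiplication. [cite: MoonenZarhin1999LowDim, §3 Prop. (3.8) (p0007 L55–L74)] -/
theorem IsRiemannForm.hodgeGroupC_prod_ellipticPeriod_eq_blockDiagProd_of_center_eq_bot
    (hη₁ : IsRiemannForm Φ₁ η₁) (hCM : ellipticEnd hτ ≠ ⊥) (hbot : Subalgebra.center ℚ (endAlgRat Φ₁) = ⊥) :
    hodgeGroupC (prodPeriod Φ₁ (ellipticPeriod hτ)) = blockDiagProd (hodgeGroupC Φ₁) (hodgeGroupC (ellipticPeriod hτ)) := by
  refine hη₁.hodgeGroupC_prod_ellipticPeriod_eq_blockDiagProd_of_forall_im_eq_zero hτ hCM fun χ c ↦ ?_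
  have hc : (c : endAlgRat Φ₁) ∈ (⊥ : Subalgebra ℚ (endAlgRat Φ₁)) := hbot ▸ c.2
  obtain ⟨q, hq⟩ := Set.mem_range.1 (Algebra.mem_bot.1 hc)
  have hcq : c = algebraMap ℚ (Subalgebra.center ℚ (endAlgRat Φ₁)) q :=
    Subtype.ext (by rw [Subalgebra.coe_algebraMap, hq])
  rw [hcq, AlgHom.commutes, eq_ratCast, Complex.ratCast_im]

/-- The same for an abelian variety `X` (some polarisation): real complex embeddings of the centre force the splitting.
[cite: MoonenZarhin1999LowDim, §3 Prop. (3.8) (p0007 L65–L74)] -/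
theorem IsAbelianVariety.hodgeGroupC_prod_ellipticPeriod_eq_blockDiagProd_of_forall_im_eq_zero
    (hX : IsAbelianVariety Φ₁) (hCM : ellipticEnd hτ ≠ ⊥)
    (hreal : ∀ χ : Subalgebra.center ℚ (endAlgRat Φ₁) →ₐ[ℚ] ℂ, ∀ c, (χ c).im = 0) :
    hodgeGroupC (prodPeriod Φ₁ (ellipticPeriod hτ)) = blockDiagProd (hodgeGroupC Φ₁) (hodgeGroupC (ellipticPeriod hτ)) := by
  obtain ⟨η₁, hη₁⟩ := hX
  exact hη₁.hodgeGroupC_prod_ellipticPeriod_eq_blockDiagProd_of_forall_im_eq_zero hτ hCM hreal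

/-- The same for an abelian variety `X` with centre `ℚ`. [cite: MoonenZarhin1999LowDim, §3 Prop. (3.8) (p0007 L55–L74)] -/
theorem IsAbelianVariety.hodgeGroupC_prod_ellipticPeriod_eq_blockDiagProd_of_center_eq_bot
    (hX : IsAbelianVariety Φ₁) (hCM : ellipticEnd hτ ≠ ⊥) (hbot : Subalgebra.center ℚ (endAlgRat Φ₁) = ⊥) :
    hodgeGroupC (prodPeriod Φ₁ (ellipticPeriod hτ)) = blockDiagProd (hodgeGroupC Φ₁) (hodgeGroupC (ellipticPeriod hτ)) := by
  obtain ⟨η₁, hη₁⟩ := hX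
  exact hη₁.hodgeGroupC_prod_ellipticPeriod_eq_blockDiagProd_of_center_eq_bot hτ hCM hbot

end Hodge

end ComplexTorus

end Literature.Geometry.Kaehler
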